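import Mathlib
import Summits.CriticalPhenomena.CardyFormulaZ2.Theorems.CardyMagicRigidityNestingRigidityTowerPressureSanity
import HarnessLib

/-!
# A-priori polynomial UPPER bound on the tower moments, II: occupation patterns of the cells
# (helper [B-up] of line `positive-cone-weight-doubling`, crux `NestingRigidity`)

Crux `Summit.CriticalPhenomena.CardyFormulaZ2.Theses.CardyMagicRigidity.NestingRigidity`
(stmt-CriticalPhenomena-4835), line `positive-cone-weight-doubling`, registered helper
`towerMoment_upper_latticeEnsembles` ([B-up]).  The loops of the tower are sorted into the `B` thin
cells of `…TowerMomentUpperCells`; a cell holding `m i` of them is crossed `m i` times disjointly, and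
ONE van den Berg–Kesten–Reimer product over all cells bounds the probability of the occupation
PATTERN `m : Fin B → ℕ` by `p ^ (∑ i, m i)`, `p` the crossing probability of one cell.  This file is
the model-free bookkeeping of that argument (pure combinatorics and measure theory, no lattice):

* `TowerMomentUpper.exists_sorting`: a finite set `S` of at most `M` objects with a cell map
  `cell : α → Fin B` splits into the pairwise disjoint fibres `T i = {u ∈ S | cell u = i}` with
  multiplicities `m i = #T i ∈ Fin (M + 1)` and `∑ i, m i = #S`;
* `TowerMomentUpper.integral_sum_indicator_le_two_pow`: if measurable events `D m`, indexed by the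
  patterns `m : Fin B → Fin (M + 1)`, have `μ(D m) ≤ ∏ i, p ^ m i` and `v p ≤ 1/2`, then the pattern
  majorant `∑_m v ^ (∑ i, m i) 1_{D m}` is integrable with integral `≤ 2 ^ B`
  (`∑_m ∏_i (v p)^{m i} = ∏_i ∑_t (v p)^t`, `Finset.prod_univ_sum`);
* `TowerMomentUpper.two_pow_le_rpow_neg`: `2 ^ B ≤ r ^ (-C)` when `B ≤ C log₂(1/r)`;
* `TowerMomentUpper.towerMoment_le_one`: the trivial bound `E_δ[w ^ N] ≤ 1` for `0 ≤ w ≤ 1`, and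
  `TowerMomentUpper.eventually_mesh_le`: `∀ᶠ δ → 0⁺, 0 < δ ∧ c₀ δ ≤ r`.
-/

noncomputable section

open MeasureTheory Set Filter Metric
open scoped Real Topology BigOperators

namespace Summit.CriticalPhenomena.CardyFormulaZ2.Cruxes.NestingRigidity.PositiveConeWeightDoubling

open Literature.Probability.RandomPlanarGeometry
open Summit.CriticalPhenomena.CardyFormulaZ2.Cruxes.NestingRigidity.RingCloudTomography

namespace TowerMomentUpper

/-! ## Sorting a finite set into the fibres of a cell map -/

/-- **Sorting.**  A finite set `S` with `#S ≤ M` and a cell map `cell : α → Fin B` splits into the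
pairwise disjoint finite fibres `T i ⊆ S` of `cell`, with multiplicities `m i = #T i`, recorded in
`Fin (M + 1)`, summing to `#S`. -/
theorem exists_sorting {α : Type*} {S : Set α} (hS : S.Finite) {M : ℕ} (hSM : S.ncard ≤ M) {B : ℕ}
    (cell : α → Fin B) :
    ∃ (T : Fin B → Set α) (m : Fin B → Fin (M + 1)), (∀ i, T i ⊆ S) ∧ (∀ i, (T i).Finite) ∧
      (Pairwise fun i i' ↦ Disjoint (T i) (T i')) ∧ (∀ i, ∀ u ∈ T i, cell u = i) ∧
      (∀ i, ((m i : ℕ) : ℕ) = (T i).ncard) ∧ ∑ i, (m i : ℕ) = S.ncard := by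
  classical
  set T : Fin B → Set α := fun i ↦ {u ∈ S | cell u = i} with hT
  have hTS : ∀ i, T i ⊆ S := fun i ↦ Set.sep_subset _ _
  have hTle : ∀ i, (T i).ncard ≤ M := fun i ↦ (Set.ncard_le_ncard (hTS i) hS).trans hSM
  refine ⟨T, fun i ↦ ⟨(T i).ncard, Nat.lt_succ_of_le (hTle i)⟩, hTS, fun i ↦ hS.subset (hTS i),
    fun i i' hii' ↦ Set.disjoint_left.2 fun u hu hu' ↦ hii' (hu.2.symm.trans hu'.2),
    fun i u hu ↦ hu.2, fun i ↦ rfl, ?_⟩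
  -- `∑ i, #T i = #S`, through the finset of `S`
  have hTi : ∀ i, T i = ↑(hS.toFinset.filter fun u ↦ cell u = i) := fun i ↦ by
    ext u; simp [hT]
  have key := Finset.card_eq_sum_card_fiberwise (f := cell) (s := hS.toFinset) (t := Finset.univ)
    fun _ _ ↦ Finset.mem_coe.2 (Finset.mem_univ _)
  rw [Set.ncard_eq_toFinset_card S hS, key]
  refine Finset.sum_congr rfl fun i _ ↦ ?_
  simp only [hTi i, Set.ncard_coe_finset]

/-! ## The pattern majorant and its integral -/

/-- `∑_{t < M + 1} x ^ t ≤ 2` for `0 ≤ x ≤ 1/2`. -/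
theorem sum_pow_fin_le_two {x : ℝ} (hx0 : 0 ≤ x) (hx : x ≤ 1 / 2) (M : ℕ) :
    ∑ t : Fin (M + 1), x ^ (t : ℕ) ≤ 2 := by
  rw [Fin.sum_univ_eq_sum_range (fun t ↦ x ^ t) (M + 1)]
  calc ∑ t ∈ Finset.range (M + 1), x ^ t ≤ ∑ t ∈ Finset.range (M + 1), (1 / 2 : ℝ) ^ t :=
        Finset.sum_le_sum fun t _ ↦ pow_le_pow_left₀ hx0 hx t
    _ ≤ (1 / 2 : ℝ) ^ 0 / (1 - 1 / 2) := by
        rw [Finset.range_eq_Ico]; exact geom_sum_Ico_le_of_lt_one (by norm_num) (by norm_num)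
    _ = 2 := by norm_num

/-- **The pattern sum factorises**: `∑_m ∏_i x ^ (m i) = ∏_i ∑_t x ^ t ≤ 2 ^ B` for
`0 ≤ x ≤ 1/2`, the sum over all patterns `m : Fin B → Fin (M + 1)`. -/
theorem sum_prod_pow_le_two_pow {x : ℝ} (hx0 : 0 ≤ x) (hx : x ≤ 1 / 2) (B M : ℕ) :
    ∑ m : Fin B → Fin (M + 1), ∏ i, x ^ (m i : ℕ) ≤ 2 ^ B := by
  classical
  have key := Finset.prod_univ_sum (fun _ : Fin B ↦ (Finset.univ : Finset (Fin (M + 1))))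
    fun _ t ↦ x ^ (t : ℕ)
  rw [Fintype.piFinset_univ] at key
  rw [← key]
  calc ∏ _i : Fin B, ∑ t : Fin (M + 1), x ^ (t : ℕ) ≤ ∏ _i : Fin B, (2 : ℝ) :=
        Finset.prod_le_prod (fun i _ ↦ Finset.sum_nonneg fun t _ ↦ pow_nonneg hx0 _)
          fun i _ ↦ sum_pow_fin_le_two hx0 hx M
    _ = 2 ^ B := by simp

/-- **The pattern majorant has integral at most `2 ^ B`.**  On a finite measure space let `D m`
(`m : Fin B → Fin (M + 1)`) be measurable events with `μ(D m) ≤ ∏ i, p ^ (m i)` (one BK–Reimer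
product), and let the weight `v ≥ 0` satisfy `v p ≤ 1/2`.  Then
`G = ∑_m 1_{D m} · v ^ (∑ i, m i)` is integrable and `∫ G dμ ≤ 2 ^ B`. -/
theorem integral_sum_indicator_le_two_pow {Ω : Type*} [MeasurableSpace Ω] (μ : Measure Ω)
    [IsFiniteMeasure μ] {B M : ℕ} (D : (Fin B → Fin (M + 1)) → Set Ω) (hD : ∀ m, MeasurableSet (D m))
    {p v : ℝ} (hp : 0 ≤ p) (hv : 0 ≤ v) (hvp : v * p ≤ 1 / 2)
    (hμ : ∀ m, μ.real (D m) ≤ ∏ i, p ^ (m i : ℕ)) :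
    Integrable (fun ω ↦ ∑ m : Fin B → Fin (M + 1),
      (D m).indicator (fun _ ↦ v ^ (∑ i, (m i : ℕ))) ω) μ ∧
    ∫ ω, ∑ m : Fin B → Fin (M + 1), (D m).indicator (fun _ ↦ v ^ (∑ i, (m i : ℕ))) ω ∂μ ≤ 2 ^ B := by
  have hint : ∀ m : Fin B → Fin (M + 1),
      Integrable (fun ω ↦ (D m).indicator (fun _ ↦ v ^ (∑ i, (m i : ℕ))) ω) μ :=
    fun m ↦ (integrable_const _).indicator (hD m)
  refine ⟨integrable_finsetSum _ fun m _ ↦ hint m, ?_⟩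
  rw [integral_finsetSum _ fun m _ ↦ hint m]
  calc ∑ m : Fin B → Fin (M + 1), ∫ ω, (D m).indicator (fun _ ↦ v ^ (∑ i, (m i : ℕ))) ω ∂μ
      = ∑ m : Fin B → Fin (M + 1), μ.real (D m) * v ^ (∑ i, (m i : ℕ)) := by
        refine Finset.sum_congr rfl fun m _ ↦ ?_
        rw [integral_indicator_const _ (hD m), smul_eq_mul, Measure.real]
    _ ≤ ∑ m : Fin B → Fin (M + 1), ∏ i, (v * p) ^ (m i : ℕ) := by
        refine Finset.sum_le_sum fun m _ ↦ ?_
        calc μ.real (D m) * v ^ (∑ i, (m i : ℕ)) ≤ (∏ i, p ^ (m i : ℕ)) * v ^ (∑ i, (m i : ℕ)) :=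
              mul_le_mul_of_nonneg_right (hμ m) (pow_nonneg hv _)
          _ = ∏ i, (v * p) ^ (m i : ℕ) := by
              rw [← Finset.prod_pow_eq_pow_sum, ← Finset.prod_mul_distrib]
              exact Finset.prod_congr rfl fun i _ ↦ by rw [mul_pow, mul_comm]
    _ ≤ 2 ^ B := sum_prod_pow_le_two_pow (mul_nonneg hv hp) hvp B M

/-- A single pattern is dominated by the pattern majorant: if `ω ∈ D m₀` then
`v ^ (∑ i, m₀ i) ≤ ∑_m 1_{D m}(ω) v ^ (∑ i, m i)` (`v ≥ 0`). -/
theorem pow_le_sum_indicator {Ω : Type*} {B M : ℕ} (D : (Fin B → Fin (M + 1)) → Set Ω) {v : ℝ}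
    (hv : 0 ≤ v) {m₀ : Fin B → Fin (M + 1)} {ω : Ω} (hω : ω ∈ D m₀) :
    v ^ (∑ i, (m₀ i : ℕ)) ≤
      ∑ m : Fin B → Fin (M + 1), (D m).indicator (fun _ ↦ v ^ (∑ i, (m i : ℕ))) ω := by
  have h := Finset.single_le_sum (f := fun m : Fin B → Fin (M + 1) ↦
      (D m).indicator (fun _ ↦ v ^ (∑ i, (m i : ℕ))) ω)
    (fun m _ ↦ Set.indicator_nonneg (fun _ _ ↦ pow_nonneg hv _) ω) (Finset.mem_univ m₀)
  rwa [Set.indicator_of_mem hω] at h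

/-- The elementary inequality behind the splitting of the two loop types:
`v ^ a * v ^ b ≤ ((v²) ^ a + (v²) ^ b) / 2`. -/
theorem pow_mul_pow_le_half_add (v : ℝ) (a b : ℕ) :
    v ^ a * v ^ b ≤ ((v ^ 2) ^ a + (v ^ 2) ^ b) / 2 := by
  rw [← pow_mul, ← pow_mul, mul_comm 2 a, mul_comm 2 b, pow_mul, pow_mul]
  nlinarith [sq_nonneg (v ^ a - v ^ b)]

/-! ## From the number of cells to a power of `r` -/

/-- `2 ^ B ≤ r ^ (-C)` as soon as `B ≤ C log₂(1/r)` (`0 < r`). -/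
theorem two_pow_le_rpow_neg {B : ℕ} {C r : ℝ} (hr : 0 < r) (hB : (B : ℝ) ≤ C * Real.logb 2 (1 / r)) :
    (2 : ℝ) ^ B ≤ r ^ (-C) := by
  calc (2 : ℝ) ^ B = 2 ^ (B : ℝ) := (Real.rpow_natCast 2 B).symm
    _ ≤ 2 ^ (Real.logb 2 (1 / r) * C) := by
        rw [mul_comm] at hB; exact Real.rpow_le_rpow_of_exponent_le one_le_two hB
    _ = (1 / r) ^ C := by
        rw [Real.rpow_mul zero_le_two, Real.rpow_logb two_pos (by norm_num) (by positivity)]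
    _ = r ^ (-C) := by rw [Real.rpow_neg hr.le, one_div, Real.inv_rpow hr.le]

/-! ## Two trivialities on the tower moment -/

/-- **Weights `w ≤ 1` are trivial**: `E_δ[w ^ N_0(ρ,1)] ≤ 1` on both lattice ensembles
(`0 ≤ w ≤ 1`, every mesh and radius). -/
theorem towerMoment_le_one : ∀ E ∈ latticeEnsembles, ∀ {w : ℝ}, 0 ≤ w → w ≤ 1 → ∀ δ ρ : ℝ,
    E.towerMoment w δ ρ ≤ 1 := by
  intro E hE w hw0 hw1 δ ρ
  haveI := isProbabilityMeasure_of_mem hE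
  rw [LoopEnsemble.towerMoment]
  calc ∫ ω, w ^ towerCount (E.X δ ω) 0 ρ 1 ∂E.P ≤ ∫ _, (1 : ℝ) ∂E.P :=
        integral_mono_of_nonneg (Eventually.of_forall fun ω ↦ pow_nonneg hw0 _) (integrable_const 1)
          (Eventually.of_forall fun ω ↦ pow_le_one₀ hw0 hw1)
    _ = 1 := by simp

/-- For a fixed radius `r > 0` and threshold `c₀ > 0`, small meshes satisfy `0 < δ` and `c₀ δ ≤ r`. -/
theorem eventually_mesh_le {c₀ r : ℝ} (hc₀ : 0 < c₀) (hr : 0 < r) :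
    ∀ᶠ δ in 𝓝[>] (0 : ℝ), 0 < δ ∧ c₀ * δ ≤ r := by
  have h1 : ∀ᶠ δ in 𝓝[>] (0 : ℝ), 0 < δ := self_mem_nhdsWithin
  have h2 : ∀ᶠ δ in 𝓝[>] (0 : ℝ), δ < r / c₀ :=
    nhdsWithin_le_nhds (Iio_mem_nhds (by positivity))
  filter_upwards [h1, h2] with δ hδ hδ'
  exact ⟨hδ, by rw [lt_div_iff₀ hc₀] at hδ'; linarith⟩

end TowerMomentUpper

/-! ## Anchor: the trivial half of [B-up] in registered form -/

/-- **Anchor (helper toward [B-up] `towerMoment_upper_latticeEnsembles`): weights `w ≤ 1` are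
trivial**, `E_δ[w ^ N_0(ρ,1)] ≤ 1` on both lattice ensembles (`TowerMomentUpper.towerMoment_le_one`). -/
theorem towerMoment_le_one_latticeEnsembles : ∀ E ∈ latticeEnsembles, ∀ (w δ ρ : ℝ), 0 ≤ w → w ≤ 1 → E.towerMoment w δ ρ ≤ 1 := by
  intro E hE w δ ρ hw0 hw1
  exact TowerMomentUpper.towerMoment_le_one E hE hw0 hw1 δ ρ

end Summit.CriticalPhenomena.CardyFormulaZ2.Cruxes.NestingRigidity.PositiveConeWeightDoubling

end
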